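import Summits.AtomisticToContinuum.HydrodynamicLimit.Theorems.AntiMazurCoboundariesCorrectorPressureDecayKiferGibbsDensityGNZ
import Literature.MathematicalPhysics.KineticTheory.RegularStationaryState

/-!
# The GNZ density sandwich for hard-sphere Gibbs states, III: `z - 8z² ≤ ρ ≤ z` for translation-invariant states

Helper file (3/3) of crux stmt-AtomisticToContinuum-14135 `AntiMazurCoboundaries.CorrectorPressureDecay`, line `FirstLemma`
(idea `kifer-compactification`), namespace `…Theorems.KiferCompactification`; registered helper stub
`stub_gibbsDensitySandwich`; serves the former stub `stub_ruelleDiluteHardSphereGas` and complements `…KiferActivityBound.lean`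
(`stub_activityBound`, the single-site bound `z (1 - 28ρ) ≤ ρ`) by the two-sided bound: it discharges the order
clause `z - C z² ≤ ρ(z) ≤ z` (with `C = 8`) of Ruelle's dilute-gas fact
`Literature.MathematicalPhysics.StatisticalMechanics.RuelleDiluteHardSphereGas` for EVERY translation-invariant hard-sphere Gibbs
state (not only Ruelle's cluster-expansion state), leaving existence at small activity
(`Theses.RelEntropyErgodic.LowActivityGibbsState`) and continuity of `z ↦ ρ` (low-activity uniqueness) as the fact's residual
content; in particular the activity bound `z ≤ 2ρ` holds as soon as `ρ ≤ 1/16` (`activity_le_two_mul_density`).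
`ρ = PointProcess.density μ` is the mean number of centres with position in the unit cube `[0,1)³`:

* translation invariance: every translated unit cube carries mean `ρ` (`lintegral_count_cube_eq_density`, via
  `PointConfig.count_translate` and `lintegral_map`); the exclusion ball `B(q, ε)`, `ε ≤ 1`, is covered by the eight cubes
  `q + v + [0,1)³`, `v ∈ {-1,0}³`, so `E_μ[#B(q, ε)] ≤ 8ρ` (`lintegral_count_ball_le_density`);
* the sandwich: `ρ ≤ z` (`density_le_activity`, from `…KiferGibbsDensityCore.lean` at `Λ = [0,1)³`) and
  `z ≤ ρ + 8 z ρ` (`activity_le_density_add`, the window GNZ bound of `…KiferGibbsDensityGNZ.lean` at `Λ = [0,1)³`), hence in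
  real numbers `z (1 - 8ρ) ≤ ρ ≤ z`, `z - 8 z² ≤ ρ`, and `z ≤ 2ρ` once `ρ ≤ 1/16` (`activity_density_sandwich`,
  `activity_sub_sq_le_density`, `activity_le_two_mul_density`).
-/

noncomputable section

open MeasureTheory ProbabilityTheory Set Filter Topology Function
open scoped ENNReal

namespace Summit.AtomisticToContinuum.HydrodynamicLimit.Theorems.KiferCompactification

open Literature.Analysis.FluidPDE (IsHardSphereGibbs IsTranslationInvariant HardCoreIn superposeIn gibbsWeight gibbsSpec
  maxwellPhaseMeasure)
open Literature.Analysis.FunctionSpaces (PointConfig)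
open Literature.Analysis.FunctionSpaces.Torus (unitCube measurableSet_unitCube)
open Literature.MathematicalPhysics.KineticTheory (V3)
open Literature.MathematicalPhysics.KineticTheory.PointProcess (density)

/-! ## Translation invariance: every translated unit cube carries the density -/

section Translation

/-- The density is the mean number of particles above the unit cube (product form of the cylinder). -/
theorem density_eq_lintegral_count (μ : Measure (PointConfig (V3 × V3))) :
    density μ = ∫⁻ X, ((X.count (unitCube (Fin 3) ×ˢ (univ : Set V3)) : ℕ∞) : ℝ≥0∞) ∂μ := by
  simp only [density, Set.prod_univ]

/-- **Under a translation-invariant law every translated unit cube `a + [0,1)³` carries the density.** -/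
theorem lintegral_count_cube_eq_density {μ : Measure (PointConfig (V3 × V3))} (hTI : IsTranslationInvariant μ) (a : V3) :
    ∫⁻ X, ((X.count (((fun x => x - a) ⁻¹' unitCube (Fin 3)) ×ˢ (univ : Set V3)) : ℕ∞) : ℝ≥0∞) ∂μ = density μ := by
  have hset : ((fun x : V3 => x - a) ⁻¹' unitCube (Fin 3)) ×ˢ (univ : Set V3) =
      (fun p : V3 × V3 => p + (-a, 0)) ⁻¹' (unitCube (Fin 3) ×ˢ (univ : Set V3)) := by
    ext p
    simp only [mem_prod, mem_preimage, mem_univ, and_true, Prod.fst_add, sub_eq_add_neg]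
  have hcount : ∀ X : PointConfig (V3 × V3),
      X.count (((fun x : V3 => x - a) ⁻¹' unitCube (Fin 3)) ×ˢ (univ : Set V3)) =
        (X.translate ((-a, 0) : V3 × V3)).count (unitCube (Fin 3) ×ˢ (univ : Set V3)) := fun X => by
    rw [PointConfig.count_translate, hset]
  simp_rw [hcount]
  rw [← lintegral_map (measurable_toENNReal_count (measurableSet_unitCube.prod MeasurableSet.univ))
    (PointConfig.measurable_translate ((-a, 0) : V3 × V3)), hTI (-a), density_eq_lintegral_count]

/-- The ball `B(q, ε)`, `ε ≤ 1`, is covered by the eight translated unit cubes `q + v + [0,1)³`, `v ∈ {-1, 0}³`. -/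
theorem ball_subset_iUnion_cube (q : V3) {ε : ℝ} (hε : ε ≤ 1) :
    Metric.ball q ε ⊆ ⋃ k : Fin 3 → Bool,
      (fun x : V3 => x - (q + WithLp.toLp 2 fun i => if k i then (0 : ℝ) else -1)) ⁻¹' unitCube (Fin 3) := by
  intro y hy
  rw [Metric.mem_ball, dist_eq_norm] at hy
  refine Set.mem_iUnion.2 ⟨fun i => decide (q i ≤ y i), ?_⟩
  rw [mem_preimage, Literature.Analysis.FunctionSpaces.Torus.mem_unitCube]
  intro i
  have hyi : |y i - q i| < 1 := by
    have h := PiLp.norm_apply_le (y - q) i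
    rw [PiLp.sub_apply, Real.norm_eq_abs] at h
    exact h.trans_lt (hy.trans_le hε)
  rw [abs_lt] at hyi
  simp only [PiLp.sub_apply, PiLp.add_apply]
  by_cases hqy : q i ≤ y i
  · simp only [hqy, decide_true, ↓reduceIte, add_zero, mem_Ico]
    constructor <;> linarith
  · simp only [hqy, decide_false, Bool.false_eq_true, ↓reduceIte, mem_Ico]
    constructor <;> linarith

/-- **The exclusion ball holds at most `8ρ` centres on average**: under a translation-invariant law, for `ε ≤ 1`,
`E_μ[#(particles with centre in B(q, ε))] ≤ 8 · density μ`. -/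
theorem lintegral_count_ball_le_density {μ : Measure (PointConfig (V3 × V3))} (hTI : IsTranslationInvariant μ) (q : V3)
    {ε : ℝ} (hε : ε ≤ 1) :
    ∫⁻ X, ((X.count (Metric.ball q ε ×ˢ (univ : Set V3)) : ℕ∞) : ℝ≥0∞) ∂μ ≤ 8 * density μ := by
  set cube : (Fin 3 → Bool) → Set V3 := fun k =>
    (fun x : V3 => x - (q + WithLp.toLp 2 fun i => if k i then (0 : ℝ) else -1)) ⁻¹' unitCube (Fin 3) with hcube
  have hcubem : ∀ k, MeasurableSet (cube k ×ˢ (univ : Set V3)) := fun k =>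
    ((measurable_id.sub measurable_const) measurableSet_unitCube).prod MeasurableSet.univ
  have hballm : MeasurableSet (Metric.ball q ε ×ˢ (univ : Set V3)) := Metric.isOpen_ball.measurableSet.prod MeasurableSet.univ
  have hpt : ∀ X : PointConfig (V3 × V3), ((X.count (Metric.ball q ε ×ˢ (univ : Set V3)) : ℕ∞) : ℝ≥0∞) ≤
      ∑ k : Fin 3 → Bool, ((X.count (cube k ×ˢ (univ : Set V3)) : ℕ∞) : ℝ≥0∞) := by
    intro X
    have hsub : Metric.ball q ε ×ˢ (univ : Set V3) ⊆ ⋃ k : Fin 3 → Bool, cube k ×ˢ (univ : Set V3) := by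
      rintro p ⟨hp, -⟩
      obtain ⟨k, hk⟩ := Set.mem_iUnion.1 (ball_subset_iUnion_cube q hε hp)
      exact Set.mem_iUnion.2 ⟨k, hk, mem_univ _⟩
    calc ((X.count (Metric.ball q ε ×ˢ (univ : Set V3)) : ℕ∞) : ℝ≥0∞) = X.toMeasure (Metric.ball q ε ×ˢ (univ : Set V3)) :=
          (PointConfig.toMeasure_apply X hballm).symm
      _ ≤ X.toMeasure (⋃ k : Fin 3 → Bool, cube k ×ˢ (univ : Set V3)) := measure_mono hsub
      _ ≤ ∑ k : Fin 3 → Bool, X.toMeasure (cube k ×ˢ (univ : Set V3)) := measure_iUnion_fintype_le _ _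
      _ = _ := Finset.sum_congr rfl fun k _ => PointConfig.toMeasure_apply X (hcubem k)
  calc ∫⁻ X, ((X.count (Metric.ball q ε ×ˢ (univ : Set V3)) : ℕ∞) : ℝ≥0∞) ∂μ
      ≤ ∫⁻ X, ∑ k : Fin 3 → Bool, ((X.count (cube k ×ˢ (univ : Set V3)) : ℕ∞) : ℝ≥0∞) ∂μ := lintegral_mono hpt
    _ = ∑ k : Fin 3 → Bool, ∫⁻ X, ((X.count (cube k ×ˢ (univ : Set V3)) : ℕ∞) : ℝ≥0∞) ∂μ :=
        lintegral_finsetSum _ fun k _ => measurable_toENNReal_count (hcubem k)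
    _ = ∑ _k : Fin 3 → Bool, density μ := Finset.sum_congr rfl fun k _ => lintegral_count_cube_eq_density hTI _
    _ = 8 * density μ := by
        rw [Finset.sum_const, Finset.card_univ, Fintype.card_fun, Fintype.card_bool, Fintype.card_fin, nsmul_eq_mul]
        norm_num

end Translation

/-! ## The density sandwich -/

section Sandwich

/-- **Upper bound `ρ ≤ z`**: the density of a hard-sphere Gibbs state (any diameter, `β > 0`) is at most its activity
(Ruelle 1969 (2.5)/(2.35): `ρ_Λ(x) ≤ z`, in the DLR setting). -/
theorem density_le_activity {ε z β : ℝ} {u : V3} {μ : Measure (PointConfig (V3 × V3))} (h : IsHardSphereGibbs ε z β u μ)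
    (hz : 0 ≤ z) (hβ : 0 < β) : density μ ≤ ENNReal.ofReal z := by
  rw [density_eq_lintegral_count]
  refine (lintegral_count_le_activity_mul_volume h hz hβ measurableSet_unitCube
    Literature.MathematicalPhysics.StatisticalMechanics.isBounded_unitCube).trans_eq ?_
  rw [show volume (unitCube (Fin 3)) = 1 from Literature.MathematicalPhysics.StatisticalMechanics.volume_unitCube, mul_one]

/-- **GNZ lower bound `z ≤ ρ + 8 z ρ`**: for a translation-invariant hard-sphere Gibbs state of diameter `ε ≤ 1`, activity
`z ≥ 0` and `β > 0`, `z ≤ ρ (1 + 8 z)` (`ρ` the density): the one-point GNZ inequality `ρ ≥ z · P(B(0, ε) vacant)` with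
`P(vacant) ≥ 1 - E[#B(0, ε)] ≥ 1 - 8ρ`. -/
theorem activity_le_density_add {ε z β : ℝ} {u : V3} {μ : Measure (PointConfig (V3 × V3))}
    (h : IsHardSphereGibbs ε z β u μ) (hTI : IsTranslationInvariant μ) (hz : 0 ≤ z) (hβ : 0 < β) (hε : ε ≤ 1) :
    ENNReal.ofReal z ≤ density μ + ENNReal.ofReal z * (8 * density μ) := by
  haveI := h.1
  have hmain := activity_mul_volume_le_of_isHardSphereGibbs h hz hβ measurableSet_unitCube
    Literature.MathematicalPhysics.StatisticalMechanics.isBounded_unitCube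
  rw [show volume (unitCube (Fin 3)) = 1 from Literature.MathematicalPhysics.StatisticalMechanics.volume_unitCube, mul_one,
    ← density_eq_lintegral_count] at hmain
  refine hmain.trans (add_le_add le_rfl (mul_le_mul' le_rfl ?_))
  calc ∫⁻ q in unitCube (Fin 3), ∫⁻ X, ((X.count (Metric.ball q ε ×ˢ (univ : Set V3)) : ℕ∞) : ℝ≥0∞) ∂μ
      ≤ ∫⁻ _ in unitCube (Fin 3), 8 * density μ := lintegral_mono fun q => lintegral_count_ball_le_density hTI q hε
    _ = 8 * density μ := by
        rw [setLIntegral_const, show volume (unitCube (Fin 3)) = 1 from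
          Literature.MathematicalPhysics.StatisticalMechanics.volume_unitCube, mul_one]

/-- **The density sandwich in real numbers**: if the density is `ρ`, then `z (1 - 8ρ) ≤ ρ ≤ z`. -/
theorem activity_density_sandwich {ε z β : ℝ} {u : V3} {μ : Measure (PointConfig (V3 × V3))}
    (h : IsHardSphereGibbs ε z β u μ) (hTI : IsTranslationInvariant μ) (hz : 0 ≤ z) (hβ : 0 < β) (hε : ε ≤ 1) {ρ : ℝ}
    (hρ : density μ = ENNReal.ofReal ρ) (hρ0 : 0 ≤ ρ) : z * (1 - 8 * ρ) ≤ ρ ∧ ρ ≤ z := by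
  have hU := density_le_activity h hz hβ
  have hL := activity_le_density_add h hTI hz hβ hε
  rw [hρ] at hU hL
  refine ⟨?_, (ENNReal.ofReal_le_ofReal_iff hz).1 hU⟩
  rw [← ENNReal.ofReal_ofNat 8, ← ENNReal.ofReal_mul (by norm_num), ← ENNReal.ofReal_mul hz,
    ← ENNReal.ofReal_add hρ0 (by positivity), ENNReal.ofReal_le_ofReal_iff (by positivity)] at hL
  nlinarith

/-- **`z - 8 z² ≤ ρ ≤ z`** (the order clause of Ruelle's dilute-gas fact with `C = 8`, for every translation-invariant
Gibbs state of the unit-diameter gas — or any diameter `ε ≤ 1` — at activity `z ≥ 0`). -/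
theorem activity_sub_sq_le_density {ε z β : ℝ} {u : V3} {μ : Measure (PointConfig (V3 × V3))}
    (h : IsHardSphereGibbs ε z β u μ) (hTI : IsTranslationInvariant μ) (hz : 0 ≤ z) (hβ : 0 < β) (hε : ε ≤ 1) {ρ : ℝ}
    (hρ : density μ = ENNReal.ofReal ρ) (hρ0 : 0 ≤ ρ) : z - 8 * z ^ 2 ≤ ρ ∧ ρ ≤ z := by
  obtain ⟨h1, h2⟩ := activity_density_sandwich h hTI hz hβ hε hρ hρ0
  refine ⟨?_, h2⟩
  nlinarith [mul_le_mul_of_nonneg_left h2 (by positivity : (0 : ℝ) ≤ 8 * z)]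

/-- **Activity bound for dilute states**: a translation-invariant hard-sphere Gibbs state (diameter `ε ≤ 1`, `β > 0`,
activity `z ≥ 0`) of density `ρ ≤ 1/16` has activity `z ≤ 2ρ`. -/
theorem activity_le_two_mul_density {ε z β : ℝ} {u : V3} {μ : Measure (PointConfig (V3 × V3))}
    (h : IsHardSphereGibbs ε z β u μ) (hTI : IsTranslationInvariant μ) (hz : 0 ≤ z) (hβ : 0 < β) (hε : ε ≤ 1) {ρ : ℝ}
    (hρ : density μ = ENNReal.ofReal ρ) (hρ0 : 0 ≤ ρ) (hρ1 : ρ ≤ 1 / 16) : z ≤ 2 * ρ := by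
  obtain ⟨h1, -⟩ := activity_density_sandwich h hTI hz hβ hε hρ hρ0
  nlinarith

/-- **Registered helper stub `stub_gibbsDensitySandwich`** (the order clause of Ruelle's dilute-gas fact, for every state):
a translation-invariant hard-sphere Gibbs state of diameter `ε ≤ 1`, activity `z ≥ 0` and `β > 0` whose density is `ρ` satisfies
`z - 8 z² ≤ ρ ≤ z`. -/
theorem stub_gibbsDensitySandwich : ∀ (ε z β : ℝ) (u : V3) (μ : Measure (PointConfig (V3 × V3))) (ρ : ℝ), IsHardSphereGibbs ε z β u μ → IsTranslationInvariant μ → 0 ≤ z → 0 < β → ε ≤ 1 → Literature.MathematicalPhysics.KineticTheory.PointProcess.density μ = ENNReal.ofReal ρ → 0 ≤ ρ → z - 8 * z ^ 2 ≤ ρ ∧ ρ ≤ z :=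
  fun _ _ _ _ _ _ h hTI hz hβ hε hρ hρ0 => activity_sub_sq_le_density h hTI hz hβ hε hρ hρ0

end Sandwich

end Summit.AtomisticToContinuum.HydrodynamicLimit.Theorems.KiferCompactification
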